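import Mathlib
import Literature.AlgebraicGeometry.Resolution.DimensionFormula
import Literature.AlgebraicGeometry.Resolution.ExcellentRingsCompleteUC

/-!
# Components of `V(f₁, …, f_m)` in a complete local domain have dimension `≥ dim D − m`
# (sub-goal (A1) of stub (R) `stub_raynaudConnectedness`)

Route `SkinnerWilesDefectOne`, crux `ReducibleOrdinaryProModular` (stmt-Langlands-12919), line
`fine-selmer-codimension-two`, registered stub (R) `stub_raynaudConnectedness` = Grothendieck's
connectedness theorem [SGA 2, Exp. XIII, Thm. 2.1] (`…GrothendieckConnectednessReduction.lean`).  This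
file proves the dimension bookkeeping (A1) used throughout the inductive proof of SGA 2 XIII 2.1: in a
COMPLETE Noetherian local DOMAIN `D`, if `f₁, …, f_m ∈ 𝔪` and `e + m ≤ dim D`, then every minimal
prime `Q` of `D/(f₁, …, f_m)` has `dim (D/(f₁, …, f_m))/Q ≥ e`.

Proof (Matsumura §5 p. 31, Thm. 13.5; Stacks 032C): `Q = Q'/(f)` for a prime `Q'` of `D` minimal
over `(f₁, …, f_m)`, so `ht Q' ≤ m` by Krull's height theorem (Mathlib
`Ideal.height_le_card_of_mem_minimalPrimes_span_finset`); a complete Noetherian local ring is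
universally catenary (tree `isUniversallyCatenaryRing_of_isAdicComplete`, Stacks 032C), and in a
catenary Noetherian local domain the **dimension formula** `ht P + dim D/P = dim D` holds for every
prime `P` (tree `IsCatenaryRing.height_eq_height_add_height_map_quotientMk`: a saturated chain
`(0) ⊂ ⋯ ⊂ P` followed by a saturated chain `P ⊂ ⋯ ⊂ 𝔪` is a maximal chain, of length `dim D`);
hence `dim D/Q' = dim D − ht Q' ≥ (e + m) − m = e`, and `(D/(f))/Q ≅ D/Q'`.

* `Theorems.height_add_ringKrullDim_quotient_eq_of_isCatenaryRing_of_isDomain` — the dimension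
  formula `ht P + dim D/P = dim D` in a catenary Noetherian local domain (no completeness);
* `Theorems.le_ringKrullDim_quotient_of_height_le_of_isCatenaryRing_of_isDomain` — `ht P ≤ h`,
  `e + h ≤ dim D` ⟹ `e ≤ dim D/P`;
* `Theorems.height_le_length_of_mem_minimalPrimes_ofList` — Krull's height theorem for
  `Ideal.ofList fs`: minimal primes over `(f₁, …, f_m)` have height `≤ m`;
* `Theorems.ringKrullDim_quotQuot_eq_ringKrullDim_quotient_comap` — `dim (D/I)/Q = dim D/(Q ∩ D)`;
* `Theorems.le_ringKrullDim_quotient_of_mem_minimalPrimes_ofList_of_isCatenaryRing` — (A1) for a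
  catenary Noetherian local domain, and `…_of_isAdicComplete` — (A1) for a complete one;
* `FineSelmerCodimensionTwo.stub_raynaudConnectedness_auxDomainComponentDim` — the registered
  sub-goal, verbatim.

References: A. Grothendieck, SGA 2, Exp. XIII Thm. 2.1 [Grothendieck1968SGA2]; H. Matsumura,
*Commutative Ring Theory*, CUP 1986, §5 p. 31 (catenary rings, dimension formula), Thm. 13.5 (Krull's
height theorem), §32 p. 260 [Matsumura1987]; The Stacks Project, Tags 032C, 02IJ [StacksProject].
-/

set_option linter.dupNamespace false -- project-wide option (lakefile weak.linter.dupNamespace); `Summit.Langlands.Langlands` is the mandated namespace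
set_option autoImplicit false

namespace Summit.Langlands.Langlands.Theorems

open IsLocalRing Literature.AlgebraicGeometry.Resolution

universe u

variable {D : Type u} [CommRing D]

/-! ## 1. The dimension formula in a catenary Noetherian local domain -/

/-- **Dimension formula in a catenary Noetherian local domain**: `ht P + dim D/P = dim D` for every
prime `P` (Matsumura §5 p. 31: in a catenary local domain all maximal chains of primes have length
`dim D`; a saturated chain `(0) ⊂ ⋯ ⊂ P` of length `ht P` followed by a saturated chain `P ⊂ ⋯ ⊂ 𝔪` of
length `dim D/P` is one).  From the tree's additivity of heights
`IsCatenaryRing.height_eq_height_add_height_map_quotientMk` (`ht 𝔪 = ht P + ht(𝔪/P)`) and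
`ht 𝔪 = dim`. [cite: Matsumura1987, §5 p. 31] -/
theorem height_add_ringKrullDim_quotient_eq_of_isCatenaryRing_of_isDomain [IsDomain D]
    [IsNoetherianRing D] [IsLocalRing D] (hD : IsCatenaryRing D) (P : Ideal D) [hP : P.IsPrime] :
    (P.height : WithBot ℕ∞) + ringKrullDim (D ⧸ P) = ringKrullDim D := by
  have hPm : P ≤ maximalIdeal D := IsLocalRing.le_maximalIdeal hP.ne_top
  have hform := hD.height_eq_height_add_height_map_quotientMk hPm
  haveI : Nontrivial (D ⧸ P) := Ideal.Quotient.nontrivial_iff.mpr hP.ne_top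
  haveI : IsLocalRing (D ⧸ P) := .of_surjective' _ Ideal.Quotient.mk_surjective
  rw [IsLocalRing.map_maximalIdeal_of_surjective _ Ideal.Quotient.mk_surjective] at hform
  rw [← IsLocalRing.maximalIdeal_height_eq_ringKrullDim,
    ← IsLocalRing.maximalIdeal_height_eq_ringKrullDim, hform, WithBot.coe_add]

/-- **Coheight bound in a catenary Noetherian local domain**: a prime of height `≤ h` has
`dim D/P ≥ e` as soon as `e + h ≤ dim D` (the dimension formula, with the finite `h` cancelled).
[cite: Matsumura1987, §5 p. 31] -/
theorem le_ringKrullDim_quotient_of_height_le_of_isCatenaryRing_of_isDomain [IsDomain D]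
    [IsNoetherianRing D] [IsLocalRing D] (hD : IsCatenaryRing D) (P : Ideal D) [hP : P.IsPrime]
    {e h : ℕ} (hPh : P.height ≤ h) (hdim : ((e + h : ℕ) : WithBot ℕ∞) ≤ ringKrullDim D) :
    (e : WithBot ℕ∞) ≤ ringKrullDim (D ⧸ P) := by
  haveI : Nontrivial (D ⧸ P) := Ideal.Quotient.nontrivial_iff.mpr hP.ne_top
  haveI : IsLocalRing (D ⧸ P) := .of_surjective' _ Ideal.Quotient.mk_surjective
  rw [← height_add_ringKrullDim_quotient_eq_of_isCatenaryRing_of_isDomain hD P,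
    ← IsLocalRing.maximalIdeal_height_eq_ringKrullDim] at hdim
  rw [← IsLocalRing.maximalIdeal_height_eq_ringKrullDim]
  have h1 : ((e + h : ℕ) : ℕ∞) ≤ P.height + (maximalIdeal (D ⧸ P)).height := by
    exact_mod_cast hdim
  have h2 : (e : ℕ∞) + h ≤ (maximalIdeal (D ⧸ P)).height + h :=
    calc (e : ℕ∞) + h = ((e + h : ℕ) : ℕ∞) := (Nat.cast_add e h).symm
      _ ≤ P.height + (maximalIdeal (D ⧸ P)).height := h1
      _ ≤ h + (maximalIdeal (D ⧸ P)).height := add_le_add hPh le_rfl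
      _ = (maximalIdeal (D ⧸ P)).height + h := add_comm _ _
  exact_mod_cast (WithTop.add_le_add_iff_right (ENat.coe_ne_top h)).mp h2

/-! ## 2. Krull's height theorem for `(f₁, …, f_m)` and the double quotient -/

/-- **Krull's height theorem for a list of generators**: a prime minimal over
`Ideal.ofList fs = (f₁, …, f_m)` has height `≤ m` (Mathlib's Krull height theorem
`Ideal.height_le_card_of_mem_minimalPrimes_span_finset` for the finset of the `fᵢ`, of cardinality
`≤ m`). [cite: Matsumura1987, Thm. 13.5] -/
theorem height_le_length_of_mem_minimalPrimes_ofList [IsNoetherianRing D] (fs : List D)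
    {P : Ideal D} (hP : P ∈ (Ideal.ofList fs).minimalPrimes) : P.height ≤ fs.length := by
  classical
  have h : Ideal.ofList fs = Ideal.span (fs.toFinset : Set D) := by
    rw [List.coe_toFinset]
  rw [h] at hP
  exact (Ideal.height_le_card_of_mem_minimalPrimes_span_finset hP).trans
    (by exact_mod_cast fs.toFinset_card_le)

/-- `(D/I)/Q ≅ D/Q'` for `Q' = Q ∩ D` the preimage of `Q` (so `Q = Q'/I`); in particular the Krull
dimensions agree. [folklore] -/
theorem ringKrullDim_quotQuot_eq_ringKrullDim_quotient_comap (I : Ideal D) (Q : Ideal (D ⧸ I)) :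
    ringKrullDim ((D ⧸ I) ⧸ Q) = ringKrullDim (D ⧸ Q.comap (Ideal.Quotient.mk I)) := by
  set Q' := Q.comap (Ideal.Quotient.mk I) with hQ'def
  have hIQ' : I ≤ Q' := fun x hx => by
    rw [hQ'def, Ideal.mem_comap, Ideal.Quotient.eq_zero_iff_mem.mpr hx]
    exact Q.zero_mem
  have hQ : Q = Q'.map (Ideal.Quotient.mk I) := by
    rw [hQ'def, Ideal.map_comap_of_surjective _ Ideal.Quotient.mk_surjective]
  rw [hQ]
  exact ringKrullDim_eq_of_ringEquiv (DoubleQuot.quotQuotEquivQuotOfLE hIQ')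

/-! ## 3. (A1): components of `V(f₁, …, f_m)` in a (complete) catenary local domain -/

/-- **(A1) for a catenary Noetherian local domain.**  If `e + m ≤ dim D` then every minimal prime `Q`
of `D/(f₁, …, f_m)` has `dim (D/(f₁, …, f_m))/Q ≥ e`: `Q = Q'/(f)` with `Q'` minimal over `(f)`
(`Ideal.minimalPrimes_eq_comap`), `ht Q' ≤ m` (Krull), `dim D/Q' = dim D − ht Q' ≥ e` (dimension
formula), `(D/(f))/Q ≅ D/Q'`.  The hypothesis `fᵢ ∈ 𝔪` is not needed (if some `fᵢ` is a unit there is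
no `Q`). [cite: Matsumura1987, §5 p. 31 and Thm. 13.5] -/
theorem le_ringKrullDim_quotient_of_mem_minimalPrimes_ofList_of_isCatenaryRing [IsDomain D]
    [IsNoetherianRing D] [IsLocalRing D] (hD : IsCatenaryRing D) (fs : List D) {e : ℕ}
    (hdim : ((e + fs.length : ℕ) : WithBot ℕ∞) ≤ ringKrullDim D)
    (Q : Ideal (D ⧸ Ideal.ofList fs)) (hQ : Q ∈ minimalPrimes (D ⧸ Ideal.ofList fs)) :
    (e : WithBot ℕ∞) ≤ ringKrullDim ((D ⧸ Ideal.ofList fs) ⧸ Q) := by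
  -- `Q' = Q ∩ D` is a minimal prime of `(f₁, …, f_m)`
  have hQ' : Q.comap (Ideal.Quotient.mk (Ideal.ofList fs)) ∈ (Ideal.ofList fs).minimalPrimes := by
    rw [Ideal.minimalPrimes_eq_comap]
    exact Set.mem_image_of_mem _ hQ
  haveI : (Q.comap (Ideal.Quotient.mk (Ideal.ofList fs))).IsPrime := hQ'.1.1
  rw [ringKrullDim_quotQuot_eq_ringKrullDim_quotient_comap]
  exact le_ringKrullDim_quotient_of_height_le_of_isCatenaryRing_of_isDomain hD _
    (height_le_length_of_mem_minimalPrimes_ofList fs hQ') hdim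

/-- **(A1) for a complete Noetherian local domain** — catenarity is automatic: a complete Noetherian
local ring is excellent, in particular universally catenary (Stacks 07QW (2) / 032C, tree
`isUniversallyCatenaryRing_of_isAdicComplete`), hence catenary. [cite: StacksProject, Tag 032C] -/
theorem le_ringKrullDim_quotient_of_mem_minimalPrimes_ofList_of_isAdicComplete [IsDomain D]
    [IsNoetherianRing D] [IsLocalRing D] [IsAdicComplete (maximalIdeal D) D] (fs : List D) {e : ℕ}
    (hdim : ((e + fs.length : ℕ) : WithBot ℕ∞) ≤ ringKrullDim D)
    (Q : Ideal (D ⧸ Ideal.ofList fs)) (hQ : Q ∈ minimalPrimes (D ⧸ Ideal.ofList fs)) :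
    (e : WithBot ℕ∞) ≤ ringKrullDim ((D ⧸ Ideal.ofList fs) ⧸ Q) :=
  le_ringKrullDim_quotient_of_mem_minimalPrimes_ofList_of_isCatenaryRing
    (isUniversallyCatenaryRing_of_isAdicComplete D).isCatenaryRing fs hdim Q hQ

end Summit.Langlands.Langlands.Theorems

/-! ## 4. The registered sub-goal (verbatim signature) -/

namespace Summit.Langlands.Langlands.Cruxes.ReducibleOrdinaryProModular.FineSelmerCodimensionTwo

open IsLocalRing

-- The registered signature (verbatim below) carries `[IsDomain D]` and `[IsLocalRing D]`, both implying
-- `[Nontrivial D]`; the `overlappingInstances` linter's suggestion to drop one cannot be followed for a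
-- registered stub: silence it here only.
set_option linter.overlappingInstances false in
/-- **Registered sub-goal `stub_raynaudConnectedness_auxDomainComponentDim` (A1) of stub (R)
`stub_raynaudConnectedness`** (the dimension bookkeeping of the inductive proof of Grothendieck's
connectedness theorem, SGA 2 XIII 2.1): in a complete Noetherian local domain `D`, if
`f₁, …, f_m ∈ 𝔪` and `e + m ≤ dim D`, every minimal prime `Q` of `D/(f₁, …, f_m)` has
`e ≤ dim (D/(f₁, …, f_m))/Q` — `Theorems.le_ringKrullDim_quotient_of_mem_minimalPrimes_ofList_of_isAdicComplete`
at universe `0` (Krull's height theorem + the dimension formula in the catenary local domain `D`).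
[cite: Grothendieck1968SGA2, Exp. XIII Théorème 2.1] -/
theorem stub_raynaudConnectedness_auxDomainComponentDim :
    ∀ (D : Type) [CommRing D] [IsDomain D] [IsNoetherianRing D] [IsLocalRing D]
      [IsAdicComplete (IsLocalRing.maximalIdeal D) D] (fs : List D) (e : ℕ),
      (∀ f ∈ fs, f ∈ IsLocalRing.maximalIdeal D) →
      ((e + fs.length : ℕ) : WithBot ℕ∞) ≤ ringKrullDim D →
      ∀ Q : Ideal (D ⧸ Ideal.ofList fs), Q ∈ minimalPrimes (D ⧸ Ideal.ofList fs) →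
        (e : WithBot ℕ∞) ≤ ringKrullDim ((D ⧸ Ideal.ofList fs) ⧸ Q) :=
  fun _ _ _ _ _ _ fs _ _ hdim Q hQ =>
    Summit.Langlands.Langlands.Theorems.le_ringKrullDim_quotient_of_mem_minimalPrimes_ofList_of_isAdicComplete
      fs hdim Q hQ

end Summit.Langlands.Langlands.Cruxes.ReducibleOrdinaryProModular.FineSelmerCodimensionTwo
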